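import Summits.Ventures.HodgeRepro2.T5InertGlobalPrime

/-!
# T5InertPrimeToy — non-vacuity of «`v` stays prime in the quadratic `L / K`»: the prime `3` of
`ℚ` stays prime in `ℚ(ζ₄) = ℚ(i)`, so `[ℚ(i)_3 : ℚ_3] = 2`

Tier-5 kernel support (N3) — p8, gen 15.  §8(d): uses an L-value-free non-vanishing device: NO.

A toy instance of the hypotheses of `T5InertGlobalPrime` (README §10.5 (ii)(c)/(d)): for `L` any
fourth cyclotomic extension of `ℚ` (`[IsCyclotomicExtension {2 ^ 2} ℚ L]`, e.g. Mathlib's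
`CyclotomicField 4 ℚ`),
* `prime_three_ringOfIntegers` — `3` is prime in `𝓞 L` (Kummer–Dedekind: `𝓞 L = ℤ[ζ₄]` is monogenic
  with minimal polynomial `X² + 1`, which is irreducible mod `3` because `−1` is not a square in
  `ZMod 3`);
* `vThree` / `wThree` — the places `(3)` of `ℚ` and `(3)` of `L`, `wThree` lies over `vThree`, and
  `map_eq` : `(3) 𝓞_L = (3)` — the hypothesis `hmap` of `T5InertGlobalPrime`;
* `finrank_eq_two` — `[L : ℚ] = φ(4) = 2`;
* hence, from `T5InertGlobalPrime`, `e = 1`, `f = 2`, **`[L_{(3)} : ℚ_3] = 2`**, the uniformiser `3`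
  of `ℚ_3` stays a uniformiser of `O_{L,(3)}`, and `L_{(3)} / ℚ_3` is Galois with a non-trivial
  automorphism; `hypotheses_satisfiable_three` packages the instance.
-/

namespace Summit.Ventures.HodgeRepro2.T5InertPrimeToy

open Polynomial NumberField IsDedekindDomain HeightOneSpectrum

section PrimeThree

variable {L : Type*} [Field L] [CharZero L] [IsCyclotomicExtension {2 ^ 2} ℚ L]

/-- `(3) ⊂ ℤ` is maximal. -/
theorem isMaximal_span_three : (Ideal.span {(3 : ℤ)}).IsMaximal :=
  Ideal.IsPrime.isMaximal ((Ideal.span_singleton_prime (by norm_num)).2 Int.prime_three) (by simp)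

/-- `−1` is not a square modulo `3`. -/
theorem not_isSquare_neg_one_zmod_three : ¬ IsSquare (-1 : ZMod 3) := by
  haveI : Fact (Nat.Prime 3) := ⟨Nat.prime_three⟩
  rw [ZMod.exists_sq_eq_neg_one_iff]
  decide

/-- The fourth cyclotomic polynomial is `X² + 1`. -/
theorem cyclotomic_four_eq (R : Type*) [CommRing R] : cyclotomic 4 R = X ^ 2 + 1 := by
  have := cyclotomic_expand_eq_cyclotomic Nat.prime_two (dvd_refl 2) R
  rw [cyclotomic_two] at this
  rw [show (4:ℕ) = 2 * 2 from rfl, ← this]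
  simp [expand_X]

/-- `X² + 1` has no root modulo `3`. -/
theorem cyclotomic_four_roots_eq_zero :
    haveI := isMaximal_span_three
    letI := Ideal.Quotient.field (Ideal.span {(3 : ℤ)})
    (cyclotomic 4 (ℤ ⧸ Ideal.span {(3 : ℤ)})).roots = 0 := by
  haveI := isMaximal_span_three
  letI := Ideal.Quotient.field (Ideal.span {(3 : ℤ)})
  rw [Multiset.eq_zero_iff_forall_notMem]
  intro x hx
  rw [mem_roots (cyclotomic_ne_zero 4 _), IsRoot, cyclotomic_four_eq] at hx
  simp only [eval_add, eval_pow, eval_X, eval_one] at hx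
  apply not_isSquare_neg_one_zmod_three
  refine ⟨Int.quotientSpanEquivZMod 3 x, ?_⟩
  have h := congrArg (Int.quotientSpanEquivZMod 3) hx
  rw [map_add, map_pow, map_one, map_zero] at h
  rw [← sq]
  exact neg_eq_of_add_eq_zero_left h

/-- `X² + 1` is irreducible modulo `3` (degree `2`, no root). -/
theorem irreducible_cyclotomic_four_quot :
    Irreducible (cyclotomic 4 (ℤ ⧸ Ideal.span {(3 : ℤ)})) := by
  haveI := isMaximal_span_three
  letI := Ideal.Quotient.field (Ideal.span {(3 : ℤ)})
  refine (irreducible_iff_roots_eq_zero_of_degree_le_three ?_ ?_).2 cyclotomic_four_roots_eq_zero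
  · rw [natDegree_cyclotomic]; decide
  · rw [natDegree_cyclotomic]; decide

/-- KUMMER–DEDEKIND for `3` in `ℤ[ζ₄]`: the ideal `3 𝓞_L` is irreducible (`𝓞 L` has the power
basis `1, ζ₄` over `ℤ`, so the conductor is `⊤`, and `minpoly ℤ ζ₄ = X² + 1` is irreducible mod
`3`). -/
theorem irreducible_map_span_three :
    Irreducible (Ideal.map (algebraMap ℤ (𝓞 L)) (Ideal.span {(3 : ℤ)})) := by
  haveI : NumberField L := IsCyclotomicExtension.numberField {2 ^ 2} ℚ L
  have hζ := IsCyclotomicExtension.zeta_spec (2 ^ 2) ℚ L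
  have hmin : minpoly ℤ hζ.toInteger = cyclotomic (2 ^ 2) ℤ := by
    rw [cyclotomic_eq_minpoly hζ (by norm_num)]
    exact (minpoly.algebraMap_eq (IsFractionRing.injective (𝓞 L) L) hζ.toInteger).symm
  refine KummerDedekind.Ideal.irreducible_map_of_irreducible_minpoly (x := hζ.toInteger)
    isMaximal_span_three (by simp) ?_ (Algebra.IsIntegral.isIntegral _) ?_
  · rw [← hζ.integralPowerBasisOfPrimePow_gen, conductor_eq_top_of_powerBasis]
    simp
  · rw [hmin, map_cyclotomic]
    exact irreducible_cyclotomic_four_quot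

/-- **`3` IS PRIME IN `ℤ[ζ₄]`** (`3 ≡ 3 mod 4`). -/
theorem prime_three_ringOfIntegers : Prime (3 : 𝓞 L) := by
  haveI : NumberField L := IsCyclotomicExtension.numberField {2 ^ 2} ℚ L
  have h := irreducible_map_span_three (L := L)
  rw [Ideal.map_span, Set.image_singleton, map_ofNat] at h
  have h3 : (3 : 𝓞 L) ≠ 0 := by
    have : ((3 : ℕ) : 𝓞 L) ≠ 0 := Nat.cast_ne_zero.2 (by norm_num)
    exact_mod_cast this
  exact (Ideal.span_singleton_prime h3).1
    (Ideal.isPrime_of_prime (UniqueFactorizationMonoid.irreducible_iff_prime.1 h))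

end PrimeThree

section Places

/-- `3` is prime in `𝓞 ℚ` (transport of `Int.prime_three` along `𝓞 ℚ ≃+* ℤ`). -/
theorem prime_three_ringOfIntegers_rat : Prime (3 : 𝓞 ℚ) :=
  (MulEquiv.prime_iff Rat.ringOfIntegersEquiv).1 (by rw [map_ofNat]; exact Int.prime_three)

/-- The place `(3)` of `ℚ`. -/
noncomputable def vThree : HeightOneSpectrum (𝓞 ℚ) where
  asIdeal := Ideal.span {(3 : 𝓞 ℚ)}
  isPrime := (Ideal.span_singleton_prime prime_three_ringOfIntegers_rat.ne_zero).2
    prime_three_ringOfIntegers_rat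
  ne_bot := by simp [prime_three_ringOfIntegers_rat.ne_zero]

/-- `vThree.asIdeal = (3)`. -/
theorem vThree_asIdeal : vThree.asIdeal = Ideal.span {(3 : 𝓞 ℚ)} := rfl

variable (L : Type*) [Field L] [CharZero L] [IsCyclotomicExtension {2 ^ 2} ℚ L]

/-- The place `(3)` of a fourth cyclotomic extension `L` of `ℚ`. -/
noncomputable def wThree :
    haveI : NumberField L := IsCyclotomicExtension.numberField {2 ^ 2} ℚ L
    HeightOneSpectrum (𝓞 L) :=
  haveI : NumberField L := IsCyclotomicExtension.numberField {2 ^ 2} ℚ L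
  { asIdeal := Ideal.span {(3 : 𝓞 L)}
    isPrime := (Ideal.span_singleton_prime prime_three_ringOfIntegers.ne_zero).2
      prime_three_ringOfIntegers
    ne_bot := by simp [prime_three_ringOfIntegers.ne_zero] }

/-- `(wThree L).asIdeal = (3)`. -/
theorem wThree_asIdeal :
    haveI : NumberField L := IsCyclotomicExtension.numberField {2 ^ 2} ℚ L
    (wThree L).asIdeal = Ideal.span {(3 : 𝓞 L)} := rfl

/-- THE HYPOTHESIS `hmap` OF `T5InertGlobalPrime`: `(3) 𝓞_L = (3)`. -/
theorem map_eq :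
    haveI : NumberField L := IsCyclotomicExtension.numberField {2 ^ 2} ℚ L
    vThree.asIdeal.map (algebraMap (𝓞 ℚ) (𝓞 L)) = (wThree L).asIdeal := by
  haveI : NumberField L := IsCyclotomicExtension.numberField {2 ^ 2} ℚ L
  rw [vThree_asIdeal, wThree_asIdeal, Ideal.map_span, Set.image_singleton, map_ofNat]

/-- `wThree` lies over `vThree`. -/
theorem liesOver :
    haveI : NumberField L := IsCyclotomicExtension.numberField {2 ^ 2} ℚ L
    (wThree L).asIdeal.LiesOver vThree.asIdeal := by
  haveI : NumberField L := IsCyclotomicExtension.numberField {2 ^ 2} ℚ L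
  refine ⟨vThree.isMaximal.eq_of_le (Ideal.comap_ne_top _ (wThree L).isPrime.ne_top) ?_⟩
  exact Ideal.le_comap_of_map_le (le_of_eq (map_eq L))

/-- `[L : ℚ] = φ(4) = 2`. -/
theorem finrank_eq_two : Module.finrank ℚ L = 2 := by
  rw [IsCyclotomicExtension.Rat.finrank (2 ^ 2) L]
  decide

/-- NON-VACUITY: the hypotheses of `T5InertGlobalPrime` hold simultaneously for
`(K, L, v, w) = (ℚ, ℚ(ζ₄), (3), (3))`. -/
theorem hypotheses_satisfiable_three :
    haveI : NumberField L := IsCyclotomicExtension.numberField {2 ^ 2} ℚ L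
    ∃ (v : HeightOneSpectrum (𝓞 ℚ)) (w : HeightOneSpectrum (𝓞 L)),
      w.asIdeal.LiesOver v.asIdeal ∧ v.asIdeal.map (algebraMap (𝓞 ℚ) (𝓞 L)) = w.asIdeal ∧
        Module.finrank ℚ L = 2 :=
  ⟨vThree, wThree L, liesOver L, map_eq L, finrank_eq_two L⟩

/-- `e((3)/(3)) = 1`. -/
theorem ramificationIdx'_eq_one :
    haveI : NumberField L := IsCyclotomicExtension.numberField {2 ^ 2} ℚ L
    vThree.asIdeal.ramificationIdx' (wThree L).asIdeal = 1 := by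
  haveI : NumberField L := IsCyclotomicExtension.numberField {2 ^ 2} ℚ L
  exact T5InertGlobalPrime.ramificationIdx'_eq_one_of_staysPrime vThree (wThree L) (map_eq L)

/-- `f((3)/(3)) = 2`. -/
theorem inertiaDeg'_eq_two :
    haveI : NumberField L := IsCyclotomicExtension.numberField {2 ^ 2} ℚ L
    haveI := liesOver L
    vThree.asIdeal.inertiaDeg' (wThree L).asIdeal = 2 := by
  haveI : NumberField L := IsCyclotomicExtension.numberField {2 ^ 2} ℚ L
  haveI := liesOver L
  exact T5InertGlobalPrime.inertiaDeg'_eq_two_of_staysPrime vThree (wThree L) (finrank_eq_two L)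
    (map_eq L)

/-- **`[L_{(3)} : ℚ_3] = 2`** for `L = ℚ(ζ₄)`: the local degree of the record's inert-place
package, on a concrete instance. -/
theorem finrank_adicCompletion_eq_two :
    haveI : NumberField L := IsCyclotomicExtension.numberField {2 ^ 2} ℚ L
    haveI := liesOver L
    Module.finrank (vThree.adicCompletion ℚ) ((wThree L).adicCompletion L) = 2 := by
  haveI : NumberField L := IsCyclotomicExtension.numberField {2 ^ 2} ℚ L
  haveI := liesOver L
  exact T5InertGlobalPrime.finrank_adicCompletion_eq_two_of_staysPrime vThree (wThree L)
    (finrank_eq_two L) (map_eq L)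

/-- `L_{(3)} / ℚ_3` has a non-trivial automorphism (the Galois conjugation of the package). -/
theorem exists_algEquiv_ne_one :
    haveI : NumberField L := IsCyclotomicExtension.numberField {2 ^ 2} ℚ L
    haveI := liesOver L
    ∃ σ : (wThree L).adicCompletion L ≃ₐ[vThree.adicCompletion ℚ] (wThree L).adicCompletion L,
      σ ≠ 1 := by
  haveI : NumberField L := IsCyclotomicExtension.numberField {2 ^ 2} ℚ L
  haveI := liesOver L
  exact T5InertGlobalPrime.exists_algEquiv_ne_one_of_staysPrime vThree (wThree L)
    (finrank_eq_two L) (map_eq L)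

end Places

end Summit.Ventures.HodgeRepro2.T5InertPrimeToy
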